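import Mathlib.Analysis.Complex.Exponential
import Mathlib.Analysis.Calculus.MeanValue
import Mathlib.Analysis.SpecificLimits.Normed
import Mathlib.Topology.MetricSpace.Contracting
import Mathlib.LinearAlgebra.Matrix.Nondegenerate
import Mathlib.Algebra.MvPolynomial.Cardinal
import Mathlib.Data.Nat.Log
import Literature.Analysis.ValidatedNumerics.IntervalEnclosure
import Literature.NumberTheory.Transcendental.ZilberFieldCCP
import HarnessLib

/-!
# Certified Khovanskii codes for the exponential-algebraic core `E = ecl ∅` of `ℂ_exp`

Definition request `defn-KhovCode` of the route `Schanuel/ArithmeticalComplexity` (card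
schanuel-arithmetical-complexity, DEF; item `EffectiveCore`, stmt-Schanuel-4024). Kirby's core
`E = ecl^ℂ(∅)` (`Literature.NumberTheory.Transcendental.ecl`, Kirby 2010 Def. 3.1–3.2) is the set
of coordinates of *non-degenerate* zeros `v ∈ ℂⁿ` of square systems `F(v, e^v) = 0`,
`F = (F₁, …, Fₙ)`, `Fᵢ ∈ ℤ[X₁, …, Xₙ, Y₁, …, Yₙ]` (`det (∂ⱼFᵢ + Yⱼ ∂_{n+j}Fᵢ)(v, e^v) ≠ 0`). A
**Khovanskii code** presents such a zero by finite data, and a **certificate** — a finite exact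
rational computation — guarantees that the data isolate exactly one zero. This is the device by
which Macintyre–Wilkie (1996, Thm 4.1) and Jones–Servi (2011, §4) effectively enumerate (real)
Khovanskii points; here it is carried out over `ℂ` with Krawczyk's interval-Newton test
(Krawczyk 1969; Moore 1977; Neumaier 1990, Thm 5.1.8).

## Contents

* `CBox` — rectangular complex intervals `[a,b] + i[c,d]` with *rational* end points (exact
  arithmetic: `add/sub/neg/mul/smul/npow/widen`, sums `lsum`, products `lprod`), reusing the
  tree's rational interval layer `NonemptyInterval ℚ` / `NonemptyInterval.mooreMul`
  (`Literature/Analysis/ValidatedNumerics/IntervalEnclosure.lean`); `CBox.cexp N` — an enclosure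
  of `exp` (complex Taylor polynomial with `N+1` terms and the remainder of `Complex.exp_bound`
  on `‖z‖ ≤ 1/2`, range reduction `e^z = (e^{z/2^s})^{2^s}`); `CBox.polyEncl` — the natural
  interval extension of an integer polynomial in the variables `Fin n ⊕ Fin n`. Each operation
  has its inclusion theorem (`CBox.mem_mul`, `CBox.mem_cexp`, `CBox.mem_polyEncl`, …).
* `KhovCode` — the codes `c = (n, F, q, r, Y, prec)`: system `F : Fin n → ℤ[X, Y]`, Gaussian
  rational centre `q : Fin n → ℚ × ℚ` and rational radius `r` of a closed polydisc
  `KhovCode.ball c = {v | ‖v - q‖_∞ ≤ r}`, a Gaussian rational preconditioner `Y` (an approximate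
  inverse Jacobian) and a precision `prec : ℕ`.
* `KhovCode.sysMap F v = (Fᵢ(v, e^v))ᵢ`, `KhovCode.jacPoly`, `KhovCode.sysJac F v` (the Jacobian,
  literally the matrix inlined in the route's items), `KhovCode.IsNondegZero`.
* `KhovCode.Cert c : Bool` — **the decidable certificate**: `0 < r`, the row-sum bound
  `θ = lipConst c` of the box enclosure of `I - Y·J(v)` over the polydisc is `< 1`, and the
  enclosed Newton correction satisfies `‖(Y F(q, e^q))ᵢ‖ ≤ (1 - θ) r` for all `i` (on squares, so
  that everything is a comparison of rationals).
* `KhovCode.point c` — the zero presented by the code (by choice; meaningful when certified).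

## Main results (all proved)

* `KhovCode.cert_sound` — if `Cert c` then the polydisc contains **exactly one** zero of
  `F(v, e^v)`, the Jacobian is invertible at **every** point of the polydisc, and `Y` is
  invertible. Proof: `g(v) = v - Y F(v)` has derivative `I - Y J(v)`
  (`hasStrictFDerivAt_khovanskiiMap` of `ZilberFieldCCP.lean`) of operator norm `≤ θ` on the
  convex polydisc, hence is `θ`-Lipschitz there (mean value inequality) and maps the polydisc
  into itself; Banach's fixed point theorem (`ContractingWith.exists_fixedPoint'`) and
  `‖1 - T‖ < 1 ⇒ T` unit (`Units.oneSub`) do the rest. This is Krawczyk's test in operator-norm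
  form (Neumaier 1990, Thm 5.1.8 (iii) / Thm 5.2.2; Moore 1977), for holomorphic maps of `ℂⁿ`.
* `KhovCode.point_mem_ball`, `sysMap_point`, `det_sysJac_point_ne_zero`, `isNondegZero_point`,
  `eq_point` (uniqueness), `existsUnique_zero`.
* `KhovCode.point_mem_core` — coordinates of points of certified codes lie in the core, stated
  with the core inlined verbatim as in the route; `KhovCode.point_mem_ecl` — the same for the
  tree's `ecl (∅ : Set ℂ)`; `isNondegZero_iff_mem_khovanskiiSolutions`.
* `Countable KhovCode`.

## Design notes

* The preconditioner `Y` and the precision `prec` are part of the code, so that the checker only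
  *verifies* (no matrix inversion, no search); completeness — every non-degenerate zero is the
  point of certified codes of arbitrarily small radius (quantitative inverse function theorem:
  take `Y ≈ J(z)⁻¹`, `r` small, `prec` large) — and the resulting description of `E` as the set
  of coordinates of certified points are NOT in this file.
* "Decidable" means: `Cert` is a Boolean obtained from the code by finitely many exact rational
  operations (`decide` on comparisons in `ℚ`). No `Primcodable`/`Computable` encoding of codes is
  set up here (the polynomial data are `MvPolynomial`, i.e. `Finsupp`); that bookkeeping belongs
  to the route item `EffectiveCore`.
* Exact rational end points (rather than the tree's kernel-speed fixed-point engines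
  `FixedPointInterval.lean` / `MultiPrecisionInterval.lean`, which round outward at a fixed
  scale and return `Option`) keep every enclosure a total function whose width is controlled by
  `r` and `prec` alone, which is what the completeness analysis needs.
* The polydisc is `Metric.closedBall` for the sup norm of `Fin n → ℂ`; coordinate discs are
  enclosed by squares `CBox.disc`.

## References

* A. Macintyre, A. J. Wilkie, *On the decidability of the real exponential field*, in:
  Kreiseliana, A K Peters 1996, 441–467, Thm 4.1.
* G. Jones, T. Servi, *On the decidability of the real field with a generic power function*,
  J. Symb. Logic 76 (2011), §4 (computable generic real via MW96 Thm 4.1).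
* R. Krawczyk, *Newton-Algorithmen zur Bestimmung von Nullstellen mit Fehlerschranken*,
  Computing 4 (1969) 187–201.
* R. E. Moore, *A test for existence of solutions to nonlinear systems*, SIAM J. Numer. Anal. 14
  (1977) 611–615; *Interval Analysis*, Prentice-Hall 1966, Ch. 2–3.
* A. Neumaier, *Interval Methods for Systems of Equations*, Cambridge UP 1990, Thm 5.1.8,
  Thm 5.2.2.
* J. Kirby, *Exponential algebraicity in exponential fields*, Bull. LMS 42 (2010), Def. 3.1–3.2,
  Remark 3.4.
-/

noncomputable section

open NonemptyInterval MvPolynomial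

namespace Literature.NumberTheory.Transcendental

open Literature.Analysis.ValidatedNumerics

/-! ### Rational complex boxes -/

/-- The symmetric rational interval `[-|ρ|, |ρ|]`. [folklore] -/
def symmInterval (ρ : ℚ) : NonemptyInterval ℚ :=
  ⟨(-|ρ|, |ρ|), (neg_nonpos.mpr (abs_nonneg ρ)).trans (abs_nonneg ρ)⟩

/-- The magnitude `max (|a|, |b|)` of a rational interval `[a, b]`: an upper bound for `|x|`,
`x ∈ [a, b]` (Moore 1966, §2.2). [cite: Moore1966, §2.2] -/
def intervalMag (I : NonemptyInterval ℚ) : ℚ := max |I.fst| |I.snd|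

/-- A **rational complex box** `[a, b] + i [c, d]` (rectangular complex interval with rational
end points; Moore 1966, Ch. 2; Alefeld–Herzberger rectangular complex arithmetic). [cite: Moore1966, Ch. 2] -/
structure CBox where
  /-- the interval of real parts -/
  re : NonemptyInterval ℚ
  /-- the interval of imaginary parts -/
  im : NonemptyInterval ℚ

namespace CBox

/-- Membership of a complex number in a box: real and imaginary parts lie in the respective
(real images of the) rational intervals. [folklore] -/
def mem (B : CBox) (z : ℂ) : Prop := z.re ∈ B.re.ratCast ℝ ∧ z.im ∈ B.im.ratCast ℝ

/-- `z ∈ B` for a complex number `z` and a box `B` means `CBox.mem B z`. [folklore] -/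
instance : Membership ℂ CBox := ⟨fun B z => B.mem z⟩

/-- The Gaussian rational `q₁ + q₂ i` as a complex number. [folklore] -/
def gaussRat (q : ℚ × ℚ) : ℂ := (q.1 : ℂ) + (q.2 : ℂ) * Complex.I

/-- The point box of a Gaussian rational `q₁ + q₂ i`. [folklore] -/
def ofRat (q : ℚ × ℚ) : CBox := ⟨pure q.1, pure q.2⟩

/-- The point box `{0}`. [folklore] -/
protected def zero : CBox := ofRat (0, 0)

/-- The point box `{1}`. [folklore] -/
protected def one : CBox := ofRat (1, 0)

/-- Sum of boxes (exact). [folklore] -/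
def add (A B : CBox) : CBox := ⟨A.re + B.re, A.im + B.im⟩

/-- Difference of boxes (exact). [folklore] -/
def sub (A B : CBox) : CBox := ⟨A.re - B.re, A.im - B.im⟩

/-- Negation of a box (exact). [folklore] -/
def neg (A : CBox) : CBox := ⟨-A.re, -A.im⟩

/-- Product of boxes by rectangular complex interval arithmetic:
`re = ac - bd`, `im = ad + bc` with Moore products. [cite: Moore1966, §2.2] -/
def mul (A B : CBox) : CBox :=
  ⟨A.re.mooreMul B.re - A.im.mooreMul B.im, A.re.mooreMul B.im + A.im.mooreMul B.re⟩

/-- Scalar multiple of a box by a rational number. [folklore] -/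
def smul (q : ℚ) (A : CBox) : CBox := ⟨(pure q).mooreMul A.re, (pure q).mooreMul A.im⟩

/-- Iterated product `A^k` (`A^0 = {1}`). [folklore] -/
def npow (A : CBox) : ℕ → CBox
  | 0 => CBox.one
  | k + 1 => mul (npow A k) A

/-- Symmetric widening of a box by `|ρ|` in both directions. [folklore] -/
def widen (A : CBox) (ρ : ℚ) : CBox := ⟨A.re + symmInterval ρ, A.im + symmInterval ρ⟩

/-- The square box of centre the Gaussian rational `q` and half-side `|r|`; it contains the
closed disc of radius `r` about `q`. [folklore] -/
def disc (q : ℚ × ℚ) (r : ℚ) : CBox := widen (ofRat q) r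

/-- The magnitude bound `mag [a,b] + mag [c,d] ≥ |z|` of a box. [folklore] -/
def mag (A : CBox) : ℚ := intervalMag A.re + intervalMag A.im

/-- The bound `mag [a,b]² + mag [c,d]² ≥ |z|²` of a box. [folklore] -/
def normSqHi (A : CBox) : ℚ := intervalMag A.re ^ 2 + intervalMag A.im ^ 2

/-- The width (sum of the two side lengths) of a box: the accuracy of the enclosure; `0`
exactly for point boxes (Moore 1966, §2.2). [cite: Moore1966, §2.2] -/
def width (A : CBox) : ℚ := A.re.length + A.im.length

/-- Box enclosure of a finite sum `∑_{k ∈ l} f k` (right fold of `add`). [folklore] -/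
def lsum {ι : Type*} (l : List ι) (f : ι → CBox) : CBox :=
  l.foldr (fun k acc => add (f k) acc) CBox.zero

/-- Box enclosure of a finite product `∏_{k ∈ l} f k` (right fold of `mul`). [folklore] -/
def lprod {ι : Type*} (l : List ι) (f : ι → CBox) : CBox :=
  l.foldr (fun k acc => mul (f k) acc) CBox.one

/-! #### The exponential -/

/-- Box enclosure of the Taylor polynomial `∑_{m<N} z^m/m!`. [folklore] -/
def expTaylor (Z : CBox) : ℕ → CBox
  | 0 => CBox.zero
  | N + 1 => add (expTaylor Z N) (smul (1 / (N.factorial : ℚ)) (npow Z N))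

/-- The Taylor remainder bound `(1/2)^N (N+1)/(N! N)` of `exp` on the disc `‖z‖ ≤ 1/2`
(`Complex.exp_bound`). [folklore] -/
def expRem (N : ℕ) : ℚ := (1 / 2) ^ N * ((N + 1 : ℚ) / (N.factorial * N))

/-- Enclosure of `exp` on a box contained in the disc `‖z‖ ≤ 1/2`: Taylor polynomial of degree
`N` widened by the remainder bound. [folklore] -/
def expSmall (N : ℕ) (Z : CBox) : CBox := widen (expTaylor Z (N + 1)) (expRem (N + 1))

/-- `s`-fold iterated squaring of a box (encloses `z ^ (2^s)`). [folklore] -/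
def sqIter : ℕ → CBox → CBox
  | 0, A => A
  | s + 1, A => sqIter s (mul A A)

/-- The scaling exponent `s` with `‖z‖ ≤ 2^s / 2` on the box (`4 · normSqHi ≤ 4^s`). [folklore] -/
def expScale (Z : CBox) : ℕ := Nat.clog 4 ⌈4 * normSqHi Z⌉₊

/-- **Box enclosure of the complex exponential** with `N + 1` Taylor terms: scale the box into
the disc `‖z‖ ≤ 1/2`, enclose `exp` there by `expSmall`, and square `s` times
(`e^z = (e^{z/2^s})^{2^s}`). Exact rational arithmetic throughout. [folklore] -/
def cexp (N : ℕ) (Z : CBox) : CBox :=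
  sqIter (expScale Z) (expSmall N (smul (1 / 2 ^ expScale Z) Z))

/-! #### Integer polynomials in the variables `Fin n ⊕ Fin n` -/

/-- The list of all variables `inl 0, …, inl (n-1), inr 0, …, inr (n-1)`. [folklore] -/
def varList (n : ℕ) : List (Fin n ⊕ Fin n) :=
  (List.finRange n).map Sum.inl ++ (List.finRange n).map Sum.inr

/-- Box enclosure of the monomial `∏ₖ xₖ ^ d k`. [folklore] -/
def monoEncl {n : ℕ} (d : (Fin n ⊕ Fin n) →₀ ℕ) (A : Fin n ⊕ Fin n → CBox) : CBox :=
  lprod (varList n) fun k => npow (A k) (d k)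

/-- **Box enclosure of an integer polynomial** `p ∈ ℤ[X, Y]` at box arguments: the sum over the
support of `coeff · monomial enclosure` (natural interval extension, Moore 1966, §3.1). [cite: Moore1966, §3.1] -/
def polyEncl {n : ℕ} (p : MvPolynomial (Fin n ⊕ Fin n) ℤ) (A : Fin n ⊕ Fin n → CBox) : CBox :=
  lsum p.support.toList fun d => smul ((p.coeff d : ℤ) : ℚ) (monoEncl d A)

/-! #### Inclusion theorems -/

variable {A B : CBox} {z w : ℂ}

/-- [folklore] -/
theorem mem_def : z ∈ B ↔ z.re ∈ B.re.ratCast ℝ ∧ z.im ∈ B.im.ratCast ℝ := Iff.rfl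

/-- [folklore] -/
@[simp] theorem gaussRat_re (q : ℚ × ℚ) : (gaussRat q).re = q.1 := by simp [gaussRat]

/-- [folklore] -/
@[simp] theorem gaussRat_im (q : ℚ × ℚ) : (gaussRat q).im = q.2 := by simp [gaussRat]

/-- A rational point lies in the real image of the point interval. [folklore] -/
theorem ratCast_mem_pure (q : ℚ) : ((q : ℝ)) ∈ (pure q : NonemptyInterval ℚ).ratCast ℝ := by
  rw [ratCast_pure]; exact mem_pure_self _

/-- [folklore] -/
theorem mem_ofRat (q : ℚ × ℚ) : gaussRat q ∈ ofRat q := by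
  rw [mem_def, gaussRat_re, gaussRat_im]
  exact ⟨ratCast_mem_pure q.1, ratCast_mem_pure q.2⟩

/-- [folklore] -/
theorem mem_zero : (0 : ℂ) ∈ CBox.zero := by
  have h := mem_ofRat (0, 0)
  rwa [show gaussRat (0, 0) = 0 by simp [gaussRat]] at h

/-- [folklore] -/
theorem mem_one : (1 : ℂ) ∈ CBox.one := by
  have h := mem_ofRat (1, 0)
  rwa [show gaussRat (1, 0) = 1 by simp [gaussRat]] at h

/-- [folklore] -/
theorem mem_add (hz : z ∈ A) (hw : w ∈ B) : z + w ∈ add A B := by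
  rw [mem_def, Complex.add_re, Complex.add_im]
  exact ⟨isSoundFun₂_add hz.1 hw.1, isSoundFun₂_add hz.2 hw.2⟩

/-- [folklore] -/
theorem mem_sub (hz : z ∈ A) (hw : w ∈ B) : z - w ∈ sub A B := by
  rw [mem_def, Complex.sub_re, Complex.sub_im]
  exact ⟨isSoundFun₂_sub hz.1 hw.1, isSoundFun₂_sub hz.2 hw.2⟩

/-- [folklore] -/
theorem mem_neg (hz : z ∈ A) : -z ∈ neg A := by
  rw [mem_def, Complex.neg_re, Complex.neg_im]
  exact ⟨isSoundFun_neg hz.1, isSoundFun_neg hz.2⟩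

/-- Inclusion property of the box product (Moore 1966, Thm 3.1). [cite: Moore1966, Theorem 3.1] -/
theorem mem_mul (hz : z ∈ A) (hw : w ∈ B) : z * w ∈ mul A B := by
  rw [mem_def, Complex.mul_re, Complex.mul_im]
  exact ⟨isSoundFun₂_sub (isSoundFun₂_mooreMul hz.1 hw.1) (isSoundFun₂_mooreMul hz.2 hw.2),
    isSoundFun₂_add (isSoundFun₂_mooreMul hz.1 hw.2) (isSoundFun₂_mooreMul hz.2 hw.1)⟩

/-- [folklore] -/
theorem mem_smul (q : ℚ) (hz : z ∈ A) : (q : ℂ) * z ∈ smul q A := by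
  rw [← Complex.ofReal_ratCast, mem_def, Complex.re_ofReal_mul, Complex.im_ofReal_mul]
  exact ⟨isSoundFun₂_mooreMul (ratCast_mem_pure q) hz.1,
    isSoundFun₂_mooreMul (ratCast_mem_pure q) hz.2⟩

/-- [folklore] -/
theorem mem_npow (hz : z ∈ A) (k : ℕ) : z ^ k ∈ npow A k := by
  induction k with
  | zero => rw [pow_zero]; exact mem_one
  | succ k ih => rw [pow_succ]; exact mem_mul ih hz

/-- A real number of absolute value `≤ ρ` lies in `[-|ρ|, |ρ|]`. [folklore] -/
theorem mem_symmInterval {x : ℝ} {ρ : ℚ} (h : |x| ≤ ρ) : x ∈ (symmInterval ρ).ratCast ℝ := by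
  rw [mem_ratCast_iff]
  have hρ : (ρ : ℝ) ≤ ((|ρ| : ℚ) : ℝ) := by exact_mod_cast le_abs_self ρ
  change (((-|ρ| : ℚ)) : ℝ) ≤ x ∧ x ≤ (((|ρ| : ℚ)) : ℝ)
  rw [Rat.cast_neg]
  constructor <;> linarith [neg_abs_le x, le_abs_self x]

/-- Widening: if `z ∈ A` and `‖w - z‖ ≤ ρ` then `w ∈ A.widen ρ`. [folklore] -/
theorem mem_widen (hz : z ∈ A) {ρ : ℚ} (hw : ‖w - z‖ ≤ ρ) : w ∈ widen A ρ := by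
  have hre : |(w - z).re| ≤ ρ := (Complex.abs_re_le_norm _).trans hw
  have him : |(w - z).im| ≤ ρ := (Complex.abs_im_le_norm _).trans hw
  have h1 : z.re + (w - z).re ∈ (A.re + symmInterval ρ).ratCast ℝ :=
    isSoundFun₂_add hz.1 (mem_symmInterval hre)
  have h2 : z.im + (w - z).im ∈ (A.im + symmInterval ρ).ratCast ℝ :=
    isSoundFun₂_add hz.2 (mem_symmInterval him)
  rw [Complex.sub_re, add_sub_cancel] at h1
  rw [Complex.sub_im, add_sub_cancel] at h2
  exact ⟨h1, h2⟩

/-- The box `disc q r` contains the closed disc `‖w - q‖ ≤ r`. [folklore] -/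
theorem mem_disc {q : ℚ × ℚ} {r : ℚ} (hw : ‖w - gaussRat q‖ ≤ r) : w ∈ disc q r :=
  mem_widen (mem_ofRat q) hw

/-- `|x| ≤ intervalMag I` for `x ∈ I`. [folklore] -/
theorem abs_le_intervalMag {I : NonemptyInterval ℚ} {x : ℝ} (hx : x ∈ I.ratCast ℝ) :
    |x| ≤ (intervalMag I : ℝ) := by
  rw [mem_ratCast_iff] at hx
  simp only [intervalMag, Rat.cast_max, Rat.cast_abs]
  rcases le_total 0 x with h | h
  · rw [abs_of_nonneg h]
    exact le_max_of_le_right (hx.2.trans (le_abs_self _))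
  · rw [abs_of_nonpos h]
    exact le_max_of_le_left ((neg_le_neg hx.1).trans (neg_le_abs _))

/-- [folklore] -/
theorem intervalMag_nonneg (I : NonemptyInterval ℚ) : 0 ≤ intervalMag I :=
  le_max_of_le_left (abs_nonneg _)

/-- `‖z‖ ≤ mag A` for `z ∈ A`. [folklore] -/
theorem norm_le_mag (hz : z ∈ A) : ‖z‖ ≤ (mag A : ℝ) := by
  simp only [mag, Rat.cast_add]
  exact (Complex.norm_le_abs_re_add_abs_im z).trans
    (add_le_add (abs_le_intervalMag hz.1) (abs_le_intervalMag hz.2))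

/-- [folklore] -/
theorem mag_nonneg (A : CBox) : 0 ≤ mag A :=
  add_nonneg (intervalMag_nonneg _) (intervalMag_nonneg _)

/-- `‖z‖² ≤ normSqHi A` for `z ∈ A`. [folklore] -/
theorem sq_norm_le_normSqHi (hz : z ∈ A) : ‖z‖ ^ 2 ≤ (normSqHi A : ℝ) := by
  simp only [normSqHi, Rat.cast_add, Rat.cast_pow]
  rw [Complex.sq_norm, Complex.normSq_apply]
  have h1 := abs_le_intervalMag hz.1
  have h2 := abs_le_intervalMag hz.2
  nlinarith [sq_abs z.re, sq_abs z.im, abs_nonneg z.re, abs_nonneg z.im]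

/-- [folklore] -/
theorem normSqHi_nonneg (A : CBox) : 0 ≤ normSqHi A := by
  unfold normSqHi; positivity

/-- [folklore] -/
theorem width_nonneg (A : CBox) : 0 ≤ width A :=
  add_nonneg (length_nonneg _) (length_nonneg _)

/-- [folklore] -/
@[simp] theorem width_ofRat (q : ℚ × ℚ) : width (ofRat q) = 0 := by simp [width, ofRat]

/-- Inclusion property of `lsum`. [folklore] -/
theorem mem_lsum {ι : Type*} {l : List ι} {f : ι → CBox} {z : ι → ℂ}
    (h : ∀ k ∈ l, z k ∈ f k) : (l.map z).sum ∈ lsum l f := by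
  induction l with
  | nil => rw [List.map_nil, List.sum_nil]; exact mem_zero
  | cons a l ih =>
    rw [List.map_cons, List.sum_cons]
    exact mem_add (h a (by simp)) (ih fun k hk => h k (by simp [hk]))

/-- Inclusion property of `lprod`. [folklore] -/
theorem mem_lprod {ι : Type*} {l : List ι} {f : ι → CBox} {z : ι → ℂ}
    (h : ∀ k ∈ l, z k ∈ f k) : (l.map z).prod ∈ lprod l f := by
  induction l with
  | nil => rw [List.map_nil, List.prod_nil]; exact mem_one
  | cons a l ih =>
    rw [List.map_cons, List.prod_cons]
    exact mem_mul (h a (by simp)) (ih fun k hk => h k (by simp [hk]))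

/-! #### Soundness of the exponential enclosure -/

/-- [folklore] -/
theorem mem_expTaylor (hz : z ∈ A) (N : ℕ) :
    ∑ m ∈ Finset.range N, z ^ m / m.factorial ∈ expTaylor A N := by
  induction N with
  | zero => rw [Finset.sum_range_zero]; exact mem_zero
  | succ N ih =>
    rw [Finset.sum_range_succ]
    refine mem_add ih ?_
    have h := mem_smul (1 / (N.factorial : ℚ)) (mem_npow hz N)
    have : ((1 / (N.factorial : ℚ) : ℚ) : ℂ) * z ^ N = z ^ N / N.factorial := by
      push_cast; ring
    rw [this] at h
    exact h

/-- [folklore] -/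
theorem mem_sqIter (hz : z ∈ A) (s : ℕ) : z ^ (2 ^ s) ∈ sqIter s A := by
  induction s generalizing A z with
  | zero => rw [pow_zero, pow_one]; exact hz
  | succ s ih =>
    have h := ih (mem_mul hz hz)
    rw [pow_succ', pow_mul, sq]
    exact h

/-- The Taylor remainder of `exp` on `‖w‖ ≤ 1/2` is at most `expRem`. [folklore] -/
theorem norm_exp_sub_sum_le_expRem (hw : ‖w‖ ≤ 1 / 2) {N : ℕ} (hN : 0 < N) :
    ‖Complex.exp w - ∑ m ∈ Finset.range N, w ^ m / m.factorial‖ ≤ (expRem N : ℝ) := by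
  have h := Complex.exp_bound (x := w) (by linarith [norm_nonneg w]) hN
  refine h.trans ?_
  have hfac : (0 : ℝ) < N.factorial * N := by positivity
  have h1 : ‖w‖ ^ N ≤ (1 / 2 : ℝ) ^ N := pow_le_pow_left₀ (norm_nonneg _) hw N
  have h2 : ((N.succ : ℝ) * ((N.factorial : ℝ) * N)⁻¹) = ((N : ℝ) + 1) / (N.factorial * N) := by
    rw [div_eq_mul_inv]; push_cast; ring
  have h3 : (expRem N : ℝ) = (1 / 2 : ℝ) ^ N * (((N : ℝ) + 1) / (N.factorial * N)) := by
    simp [expRem]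
  rw [h2, h3]
  exact mul_le_mul_of_nonneg_right h1 (by positivity)

/-- [folklore] -/
theorem mem_expSmall (hw : w ∈ A) (hn : ‖w‖ ≤ 1 / 2) (N : ℕ) :
    Complex.exp w ∈ expSmall N A :=
  mem_widen (mem_expTaylor hw (N + 1)) (norm_exp_sub_sum_le_expRem hn N.succ_pos)

/-- On the box `A`, `‖z‖ ≤ 2 ^ expScale A / 2`. [folklore] -/
theorem norm_le_of_mem_expScale (hz : z ∈ A) : ‖z‖ ≤ 2 ^ expScale A / 2 := by
  have h1 : ‖z‖ ^ 2 ≤ (normSqHi A : ℝ) := sq_norm_le_normSqHi hz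
  have h2 : (4 * normSqHi A : ℚ) ≤ (4 : ℚ) ^ expScale A := by
    have hceil : (4 * normSqHi A : ℚ) ≤ (⌈4 * normSqHi A⌉₊ : ℕ) := Nat.le_ceil _
    have hclog : (⌈4 * normSqHi A⌉₊ : ℕ) ≤ 4 ^ expScale A := Nat.le_pow_clog (by norm_num) _
    exact hceil.trans (by exact_mod_cast hclog)
  have h3 : ‖z‖ ^ 2 ≤ ((2 : ℝ) ^ expScale A / 2) ^ 2 := by
    have h2' : (4 * (normSqHi A : ℝ)) ≤ (4 : ℝ) ^ expScale A := by exact_mod_cast h2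
    have : ((2 : ℝ) ^ expScale A / 2) ^ 2 = (4 : ℝ) ^ expScale A / 4 := by
      rw [div_pow, ← pow_mul, mul_comm, pow_mul]; norm_num
    rw [this]
    linarith
  exact (pow_le_pow_iff_left₀ (norm_nonneg z) (by positivity) two_ne_zero).1 h3

/-- **Inclusion property of the exponential enclosure**: `e^z ∈ cexp N A` for `z ∈ A`. [folklore] -/
theorem mem_cexp (hz : z ∈ A) (N : ℕ) : Complex.exp z ∈ cexp N A := by
  set s := expScale A with hs
  have hw : ((1 / 2 ^ s : ℚ) : ℂ) * z ∈ smul (1 / 2 ^ s) A := mem_smul _ hz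
  have hnorm : ‖((1 / 2 ^ s : ℚ) : ℂ) * z‖ ≤ 1 / 2 := by
    rw [norm_mul]
    have : ‖((1 / 2 ^ s : ℚ) : ℂ)‖ = 1 / 2 ^ s := by
      rw [show ((1 / 2 ^ s : ℚ) : ℂ) = ((1 / 2 ^ s : ℝ) : ℂ) by push_cast; ring]
      rw [Complex.norm_real, Real.norm_eq_abs, abs_of_nonneg (by positivity)]
    rw [this]
    have hz' := norm_le_of_mem_expScale hz
    rw [← hs] at hz'
    have h2s : (0 : ℝ) < 2 ^ s := by positivity
    calc 1 / 2 ^ s * ‖z‖ ≤ 1 / 2 ^ s * (2 ^ s / 2) := by gcongr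
      _ = 1 / 2 := by field_simp
  have hexp := mem_sqIter (mem_expSmall hw hnorm N) s
  rw [← Complex.exp_nat_mul] at hexp
  have : ((2 ^ s : ℕ) : ℂ) * (((1 / 2 ^ s : ℚ) : ℂ) * z) = z := by
    push_cast; field_simp
  rw [this] at hexp
  exact hexp

/-! #### Soundness of the polynomial enclosure -/

/-- [folklore] -/
theorem mem_monoEncl {n : ℕ} {x : Fin n ⊕ Fin n → ℂ} {A : Fin n ⊕ Fin n → CBox}
    (h : ∀ k, x k ∈ A k) (d : (Fin n ⊕ Fin n) →₀ ℕ) : ∏ k, x k ^ d k ∈ monoEncl d A := by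
  have hprod : ∏ k, x k ^ d k = ((varList n).map fun k => x k ^ d k).prod := by
    rw [Fintype.prod_sum_type, Fin.prod_univ_def, Fin.prod_univ_def, varList, List.map_append,
      List.prod_append, List.map_map, List.map_map]
    rfl
  rw [hprod]
  exact mem_lprod fun k _ => mem_npow (h k) (d k)

/-- **Inclusion property of the polynomial enclosure** (Moore 1966, Thm 3.1: the natural
interval extension encloses the range). [cite: Moore1966, Theorem 3.1] -/
theorem mem_polyEncl {n : ℕ} {x : Fin n ⊕ Fin n → ℂ} {A : Fin n ⊕ Fin n → CBox}
    (h : ∀ k, x k ∈ A k) (p : MvPolynomial (Fin n ⊕ Fin n) ℤ) :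
    aeval x p ∈ polyEncl p A := by
  rw [aeval_def, eval₂_eq', ← Finset.sum_map_toList]
  refine mem_lsum fun d _ => ?_
  have hm := mem_smul ((p.coeff d : ℤ) : ℚ) (mem_monoEncl h d)
  have hc : (algebraMap ℤ ℂ) (coeff d p) = (((p.coeff d : ℤ) : ℚ) : ℂ) := by simp
  rw [hc]
  exact hm

end CBox

/-! ### Khovanskii codes -/

/-- A **Khovanskii code**: a square system `F = (F₁, …, Fₙ)` of integer exponential
polynomials `Fᵢ(x, eˣ)`, `Fᵢ ∈ ℤ[X₁..Xₙ, Y₁..Yₙ]`, together with a candidate isolating polydisc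
(Gaussian rational centre `q`, rational radius `r`), a Gaussian rational preconditioning matrix
`Y` (an approximate inverse of the Jacobian) and a working precision `prec` for the enclosure of
`exp`. (Codes of this kind — system + isolating ball — present the exponential-algebraic numbers
of Macintyre–Wilkie 1996, Thm 4.1, and Jones–Servi 2011, §4; the preconditioner and precision
make the isolation test below a finite rational computation, Krawczyk 1969 / Moore 1977 /
Neumaier 1990, Thm 5.1.8.) [cite: MacintyreWilkieKreiseliana1996, Thm 4.1] -/
structure KhovCode where
  /-- number of variables and equations -/
  n : ℕ
  /-- the system: `F i` is a polynomial in `X = inl` (the variables) and `Y = inr`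
  (their exponentials) with integer coefficients -/
  F : Fin n → MvPolynomial (Fin n ⊕ Fin n) ℤ
  /-- Gaussian rational centre of the polydisc -/
  q : Fin n → ℚ × ℚ
  /-- rational radius of the polydisc -/
  r : ℚ
  /-- Gaussian rational preconditioner (approximate inverse Jacobian at the centre) -/
  Y : Fin n → Fin n → ℚ × ℚ
  /-- number of Taylor terms used to enclose `exp` -/
  prec : ℕ

namespace KhovCode

/-! #### The exponential-polynomial map of a system and its formal Jacobian -/

section System

variable {n : ℕ}

/-- The map `v ↦ (Fᵢ(v, e^v))ᵢ : ℂⁿ → ℂⁿ` of a system of integer exponential polynomials.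
[cite: Kirby2010, Def. 3.1] -/
def sysMap (F : Fin n → MvPolynomial (Fin n ⊕ Fin n) ℤ) (v : Fin n → ℂ) : Fin n → ℂ :=
  fun i => aeval (Sum.elim v (Complex.exp ∘ v)) (F i)

/-- The formal partial derivative `∂Fᵢ/∂Xⱼ + Yⱼ ∂Fᵢ/∂Yⱼ ∈ ℤ[X, Y]` (chain rule for
`xⱼ ↦ Fᵢ(x, eˣ)`; the integer-coefficient form of `Literature.NumberTheory.Transcendental.expPDeriv`). [cite: Kirby2010, Def. 3.1] -/
def jacPoly (F : Fin n → MvPolynomial (Fin n ⊕ Fin n) ℤ) (i j : Fin n) :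
    MvPolynomial (Fin n ⊕ Fin n) ℤ :=
  pderiv (Sum.inl j) (F i) + X (Sum.inr j) * pderiv (Sum.inr j) (F i)

/-- The Jacobian matrix `(∂/∂vⱼ) Fᵢ(v, e^v)` of the system at `v`. [cite: Kirby2010, Def. 3.1] -/
def sysJac (F : Fin n → MvPolynomial (Fin n ⊕ Fin n) ℤ) (v : Fin n → ℂ) :
    Matrix (Fin n) (Fin n) ℂ :=
  Matrix.of fun i j => aeval (Sum.elim v (Complex.exp ∘ v)) (jacPoly F i j)

/-- `v` is a **non-degenerate zero** of the system `F`: `F(v, e^v) = 0` and the Jacobian is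
invertible (the solutions whose coordinates form Kirby's `ecl ∅`). [cite: Kirby2010, Def. 3.1–3.2] -/
def IsNondegZero (F : Fin n → MvPolynomial (Fin n ⊕ Fin n) ℤ) (v : Fin n → ℂ) : Prop :=
  sysMap F v = 0 ∧ (sysJac F v).det ≠ 0

end System

variable (c : KhovCode)

/-- The centre of the code's polydisc, as a point of `ℂⁿ`. [folklore] -/
def centre : Fin c.n → ℂ := fun j => CBox.gaussRat (c.q j)

/-- The code's closed polydisc `{v | ∀ j, ‖vⱼ - qⱼ‖ ≤ r}` (the closed ball of the sup norm).
[folklore] -/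
def ball : Set (Fin c.n → ℂ) := Metric.closedBall c.centre c.r

/-- Box enclosing the `j`-th coordinate disc of the polydisc. [folklore] -/
def varBox (j : Fin c.n) : CBox := CBox.disc (c.q j) c.r

/-- Point box of the `j`-th coordinate of the centre. [folklore] -/
def ptBox (j : Fin c.n) : CBox := CBox.ofRat (c.q j)

/-- Boxes enclosing `(v, e^v)` for `v` in the polydisc. [folklore] -/
def argBox : Fin c.n ⊕ Fin c.n → CBox :=
  Sum.elim c.varBox fun j => CBox.cexp c.prec (c.varBox j)

/-- Boxes enclosing `(q, e^q)` at the centre `q`. [folklore] -/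
def argPt : Fin c.n ⊕ Fin c.n → CBox :=
  Sum.elim c.ptBox fun j => CBox.cexp c.prec (c.ptBox j)

/-- Enclosure of the value `Fᵢ(q, e^q)` at the centre. [folklore] -/
def valEncl (i : Fin c.n) : CBox := CBox.polyEncl (c.F i) c.argPt

/-- Enclosure of the Jacobian entry `Jᵢⱼ(v)` over the polydisc. [folklore] -/
def jacEncl (i j : Fin c.n) : CBox := CBox.polyEncl (jacPoly c.F i j) c.argBox

/-- Enclosure of the entry `(I - Y J(v))ᵢⱼ` of the Krawczyk contraction matrix `I - CA` over the
polydisc (Neumaier 1990, (5.1.13)). [cite: Neumaier1991, Thm 5.1.8] -/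
def resEncl (i j : Fin c.n) : CBox :=
  CBox.sub (if i = j then CBox.one else CBox.zero)
    (CBox.lsum (List.finRange c.n) fun k => CBox.mul (CBox.ofRat (c.Y i k)) (c.jacEncl k j))

/-- Enclosure of the Newton correction `(Y F(q, e^q))ᵢ` at the centre. [folklore] -/
def corrEncl (i : Fin c.n) : CBox :=
  CBox.lsum (List.finRange c.n) fun k => CBox.mul (CBox.ofRat (c.Y i k)) (c.valEncl k)

/-- Row sum bound `∑ⱼ mag (I - Y J)ᵢⱼ` (sup-norm operator bound, row `i`). [folklore] -/
def lipRow (i : Fin c.n) : ℚ := ∑ j, CBox.mag (c.resEncl i j)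

/-- The certified contraction constant `max_i ∑ⱼ mag (I - Y J)ᵢⱼ` (`0` for `n = 0`). [folklore] -/
def lipConst : ℚ := Finset.univ.fold max 0 c.lipRow

/-- **The certificate** (a Krawczyk–Moore isolation test in exact rational arithmetic):
`r > 0`, the contraction constant `θ = lipConst < 1`, and for every `i` the Newton correction
satisfies `‖(Y F(q, e^q))ᵢ‖ ≤ (1 - θ) r` (tested on squares). When it holds, the Krawczyk map
`v ↦ v - Y F(v, e^v)` is a `θ`-contraction of the polydisc into itself. Decidable: a Boolean
computed from the code by rational arithmetic. The operator-norm form of Krawczyk's test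
`K(x, x̃) ⊆ int x` (Krawczyk 1969; Moore 1977; Neumaier 1990, Thm 5.1.8 (iii)). [cite: Neumaier1991, Thm 5.1.8] -/
def Cert : Bool :=
  decide (0 < c.r) && decide (c.lipConst < 1) &&
    decide (∀ i : Fin c.n, CBox.normSqHi (c.corrEncl i) ≤ ((1 - c.lipConst) * c.r) ^ 2)

/-- **The point of a code**: a zero of `F(v, e^v)` in the code's polydisc if there is one (by
choice; for a certified code it is the unique zero in the polydisc, `KhovCode.eq_point`), an
unspecified point of `ℂⁿ` otherwise. [folklore] -/
def point : Fin c.n → ℂ :=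
  Classical.epsilon fun z : Fin c.n → ℂ => z ∈ c.ball ∧ sysMap c.F z = 0

/-! #### API -/

/-- Unfolding the certificate. [folklore] -/
theorem cert_iff : c.Cert = true ↔ 0 < c.r ∧ c.lipConst < 1 ∧
    ∀ i : Fin c.n, CBox.normSqHi (c.corrEncl i) ≤ ((1 - c.lipConst) * c.r) ^ 2 := by
  simp [Cert, and_assoc]

/-- If some zero of the system lies in the polydisc then `point` is such a zero. [folklore] -/
theorem point_spec (h : ∃ z, z ∈ c.ball ∧ sysMap c.F z = 0) :
    c.point ∈ c.ball ∧ sysMap c.F c.point = 0 :=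
  Classical.epsilon_spec h

/-! #### Soundness of the certificate -/

/-- The preconditioner as a complex matrix. [folklore] -/
def YC : Matrix (Fin c.n) (Fin c.n) ℂ := Matrix.of fun i k => CBox.gaussRat (c.Y i k)

/-- The Krawczyk map `v ↦ v - Y F(v, e^v)`. [folklore] -/
def kraw (v : Fin c.n → ℂ) : Fin c.n → ℂ := v - c.YC.mulVec (sysMap c.F v)

/-- The derivative `I - Y J(v)` of the Krawczyk map, as a continuous linear map. [folklore] -/
def krawDeriv (v : Fin c.n → ℂ) : (Fin c.n → ℂ) →L[ℂ] (Fin c.n → ℂ) :=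
  LinearMap.toContinuousLinearMap (Matrix.toLin' (1 - c.YC * sysJac c.F v))

section Deriv

variable {n : ℕ} (F : Fin n → MvPolynomial (Fin n ⊕ Fin n) ℤ)

/-- `sysMap` is the tree's `khovanskiiMap` of the system mapped to `ℂ` coefficients. [folklore] -/
theorem sysMap_eq_khovanskiiMap :
    sysMap F = khovanskiiMap fun i => map (Int.castRingHom ℂ) (F i) := by
  funext v i
  simp only [sysMap, khovanskiiMap, eval_map, aeval_def, algebraMap_int_eq]
  rfl

/-- `sysJac` is the tree's formal Jacobian `Khovanskii.kjac` of the mapped system. [folklore] -/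
theorem sysJac_eq_kjac (v : Fin n → ℂ) :
    sysJac F v = Khovanskii.kjac v fun i => map (Int.castRingHom ℂ) (F i) := by
  ext i j
  simp only [sysJac, Khovanskii.kjac, Matrix.of_apply, Khovanskii.ePD, jacPoly, pderiv_map,
    aeval_def, algebraMap_int_eq]
  rw [← map_X (Int.castRingHom ℂ) (Sum.inr j : Fin n ⊕ Fin n), ← map_mul, ← map_add, eval_map]
  rfl

/-- The exponential-polynomial map is differentiable with derivative the formal Jacobian
(`hasStrictFDerivAt_khovanskiiMap`). [folklore] -/
theorem hasFDerivAt_sysMap (v : Fin n → ℂ) :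
    HasFDerivAt (sysMap F) (LinearMap.toContinuousLinearMap (Matrix.toLin' (sysJac F v))) v := by
  rw [sysMap_eq_khovanskiiMap, sysJac_eq_kjac]
  exact (hasStrictFDerivAt_khovanskiiMap _ v).hasFDerivAt

end Deriv

/-- The Krawczyk map is differentiable with derivative `I - Y J(v)`. [folklore] -/
theorem hasFDerivAt_kraw (v : Fin c.n → ℂ) : HasFDerivAt c.kraw (c.krawDeriv v) v := by
  have h1 : HasFDerivAt (fun w => c.YC.mulVec (sysMap c.F w))
      ((LinearMap.toContinuousLinearMap (Matrix.toLin' c.YC)).comp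
        (LinearMap.toContinuousLinearMap (Matrix.toLin' (sysJac c.F v)))) v := by
    have := (LinearMap.toContinuousLinearMap (Matrix.toLin' c.YC)).hasFDerivAt.comp v
      (hasFDerivAt_sysMap c.F v)
    simpa only [Function.comp_def, LinearMap.coe_toContinuousLinearMap', Matrix.toLin'_apply]
      using this
  have h2 := (hasFDerivAt_id v).sub h1
  refine h2.congr_fderiv ?_
  ext w i
  simp [krawDeriv, Matrix.mulVec_mulVec]

/-- Coordinates of points of the polydisc lie in the coordinate boxes. [folklore] -/
theorem mem_varBox {v : Fin c.n → ℂ} (hv : v ∈ c.ball) (j : Fin c.n) : v j ∈ c.varBox j := by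
  refine CBox.mem_disc ?_
  rw [ball, Metric.mem_closedBall, dist_eq_norm] at hv
  exact (norm_le_pi_norm (v - c.centre) j).trans hv

/-- [folklore] -/
theorem mem_argBox {v : Fin c.n → ℂ} (hv : v ∈ c.ball) (k : Fin c.n ⊕ Fin c.n) :
    Sum.elim v (Complex.exp ∘ v) k ∈ c.argBox k := by
  rcases k with j | j
  · exact c.mem_varBox hv j
  · exact CBox.mem_cexp (c.mem_varBox hv j) _

/-- [folklore] -/
theorem mem_argPt (k : Fin c.n ⊕ Fin c.n) :
    Sum.elim c.centre (Complex.exp ∘ c.centre) k ∈ c.argPt k := by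
  rcases k with j | j
  · exact CBox.mem_ofRat (c.q j)
  · exact CBox.mem_cexp (CBox.mem_ofRat (c.q j)) _

/-- The Jacobian entries over the polydisc lie in their enclosures. [folklore] -/
theorem mem_jacEncl {v : Fin c.n → ℂ} (hv : v ∈ c.ball) (i j : Fin c.n) :
    sysJac c.F v i j ∈ c.jacEncl i j :=
  CBox.mem_polyEncl (c.mem_argBox hv) _

/-- The values at the centre lie in their enclosures. [folklore] -/
theorem mem_valEncl (i : Fin c.n) : sysMap c.F c.centre i ∈ c.valEncl i :=
  CBox.mem_polyEncl c.mem_argPt _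

/-- [folklore] -/
theorem YC_apply (i k : Fin c.n) : c.YC i k = CBox.gaussRat (c.Y i k) := rfl

/-- The entries of `I - Y J(v)`, `v` in the polydisc, lie in `resEncl`. [folklore] -/
theorem mem_resEncl {v : Fin c.n → ℂ} (hv : v ∈ c.ball) (i j : Fin c.n) :
    (1 - c.YC * sysJac c.F v) i j ∈ c.resEncl i j := by
  rw [Matrix.sub_apply, Matrix.one_apply, Matrix.mul_apply, Fin.sum_univ_def]
  refine CBox.mem_sub ?_ (CBox.mem_lsum fun k _ => ?_)
  · split_ifs
    · exact CBox.mem_one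
    · exact CBox.mem_zero
  · exact CBox.mem_mul (CBox.mem_ofRat _) (c.mem_jacEncl hv k j)

/-- The Newton correction at the centre lies in `corrEncl`. [folklore] -/
theorem mem_corrEncl (i : Fin c.n) : (c.YC.mulVec (sysMap c.F c.centre)) i ∈ c.corrEncl i := by
  simp only [Matrix.mulVec, dotProduct]
  rw [Fin.sum_univ_def]
  exact CBox.mem_lsum fun k _ => CBox.mem_mul (CBox.mem_ofRat _) (c.mem_valEncl k)

/-- Sup-norm bound for a matrix–vector product from entrywise bounds and a row-sum bound.
[folklore] -/
theorem norm_mulVec_le {n : ℕ} {M : Matrix (Fin n) (Fin n) ℂ} {b : Fin n → Fin n → ℝ}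
    (hb : ∀ i j, ‖M i j‖ ≤ b i j) {C : ℝ} (hC0 : 0 ≤ C) (hC : ∀ i, ∑ j, b i j ≤ C)
    (w : Fin n → ℂ) : ‖M.mulVec w‖ ≤ C * ‖w‖ := by
  refine (pi_norm_le_iff_of_nonneg (by positivity)).2 fun i => ?_
  simp only [Matrix.mulVec, dotProduct]
  calc ‖∑ j, M i j * w j‖ ≤ ∑ j, ‖M i j * w j‖ := norm_sum_le _ _
    _ ≤ ∑ j, b i j * ‖w‖ := Finset.sum_le_sum fun j _ => by
        rw [norm_mul]
        exact mul_le_mul (hb i j) (norm_le_pi_norm w j) (norm_nonneg _)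
          ((norm_nonneg _).trans (hb i j))
    _ = (∑ j, b i j) * ‖w‖ := (Finset.sum_mul _ _ _).symm
    _ ≤ C * ‖w‖ := mul_le_mul_of_nonneg_right (hC i) (norm_nonneg _)

/-- [folklore] -/
theorem lipRow_le_lipConst (i : Fin c.n) : c.lipRow i ≤ c.lipConst :=
  (Finset.le_fold_max _).2 (Or.inr ⟨i, Finset.mem_univ i, le_rfl⟩)

/-- [folklore] -/
theorem lipConst_nonneg : 0 ≤ c.lipConst :=
  (Finset.le_fold_max _).2 (Or.inl le_rfl)

/-- On the polydisc the derivative of the Krawczyk map has operator norm `≤ lipConst`.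
[cite: Neumaier1991, Thm 5.2.2] -/
theorem opNorm_krawDeriv_le {v : Fin c.n → ℂ} (hv : v ∈ c.ball) :
    ‖c.krawDeriv v‖ ≤ c.lipConst := by
  refine ContinuousLinearMap.opNorm_le_bound _ (by exact_mod_cast c.lipConst_nonneg) fun w => ?_
  have happ : c.krawDeriv v w = (1 - c.YC * sysJac c.F v).mulVec w := by
    simp [krawDeriv, Matrix.sub_mulVec, Matrix.one_mulVec]
  rw [happ]
  refine norm_mulVec_le (b := fun i j => (CBox.mag (c.resEncl i j) : ℝ))
    (fun i j => CBox.norm_le_mag (c.mem_resEncl hv i j)) (by exact_mod_cast c.lipConst_nonneg)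
    (fun i => ?_) w
  have := c.lipRow_le_lipConst i
  unfold lipRow at this
  exact_mod_cast this

/-- **Soundness of the certificate** (Krawczyk 1969; Moore 1977; Neumaier 1990, Thm 5.1.8 (iii);
the role it plays for exponential-polynomial systems is that of Macintyre–Wilkie 1996, Thm 4.1): for a certified code the polydisc contains exactly one zero of `F(v, e^v)`, the
Jacobian is invertible at every point of the polydisc, and the preconditioner is invertible.
Proof: the Krawczyk map `g(v) = v - Y F(v)` has derivative `I - Y J(v)` of sup-operator-norm
`≤ θ < 1` on the (convex) polydisc, so it is a `θ`-contraction there (mean value inequality);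
`‖g(q) - q‖ ≤ (1-θ) r` makes it a self-map; Banach's fixed point theorem gives a unique fixed
point, which is a zero because `Y` is invertible (`‖I - Y J‖ < 1` makes `Y J` a unit).
[cite: Neumaier1991, Thm 5.1.8] -/
theorem cert_sound (hc : c.Cert = true) :
    (∃ z ∈ c.ball, sysMap c.F z = 0 ∧ ∀ z' ∈ c.ball, sysMap c.F z' = 0 → z' = z) ∧
    (∀ v ∈ c.ball, (sysJac c.F v).det ≠ 0) ∧ c.YC.det ≠ 0 := by
  obtain ⟨hr, hθ, hcorr⟩ := c.cert_iff.1 hc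
  set θ : NNReal := ⟨c.lipConst, by exact_mod_cast c.lipConst_nonneg⟩ with hθdef
  have hθcoe : (θ : ℝ) = c.lipConst := rfl
  have hθ1 : θ < 1 := by
    rw [← NNReal.coe_lt_coe, hθcoe, NNReal.coe_one]; exact_mod_cast hθ
  have hconv : Convex ℝ c.ball := convex_closedBall _ _
  -- Lipschitz on the polydisc
  have hlip : LipschitzOnWith θ c.kraw c.ball :=
    hconv.lipschitzOnWith_of_nnnorm_hasFDerivWithin_le
      (fun v _ => (c.hasFDerivAt_kraw v).hasFDerivWithinAt)
      (fun v hv => by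
        rw [← NNReal.coe_le_coe, coe_nnnorm, hθcoe]
        exact c.opNorm_krawDeriv_le hv)
  -- invertibility on the polydisc
  have hunit : ∀ v ∈ c.ball, (c.YC * sysJac c.F v).det ≠ 0 := by
    intro v hv
    have hlt : ‖c.krawDeriv v‖ < 1 :=
      (c.opNorm_krawDeriv_le hv).trans_lt (by exact_mod_cast hθ)
    have hu : IsUnit (1 - c.krawDeriv v) := (Units.oneSub (c.krawDeriv v) hlt).isUnit
    have heq : 1 - c.krawDeriv v =
        LinearMap.toContinuousLinearMap (Matrix.toLin' (c.YC * sysJac c.F v)) := by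
      ext w i
      simp [krawDeriv]
    rw [heq] at hu
    have hu' : IsUnit (Matrix.toLin' (c.YC * sysJac c.F v)) := by
      have := hu.map ContinuousLinearMap.toLinearMapRingHom
      simpa using this
    have hdet := hu'.map LinearMap.det
    rw [LinearMap.det_toLin'] at hdet
    exact hdet.ne_zero
  have hYdet : c.YC.det ≠ 0 := by
    have hcen : c.centre ∈ c.ball := Metric.mem_closedBall_self (by exact_mod_cast hr.le)
    have := hunit c.centre hcen
    rw [Matrix.det_mul] at this
    exact left_ne_zero_of_mul this
  -- self-map
  have h0 : (0 : ℝ) ≤ (1 - c.lipConst) * c.r := by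
    have h1 : (c.lipConst : ℝ) < 1 := by exact_mod_cast hθ
    have h2 : (0 : ℝ) < c.r := by exact_mod_cast hr
    nlinarith
  have hcorr' : ∀ i, ‖(c.YC.mulVec (sysMap c.F c.centre)) i‖ ≤ (1 - c.lipConst) * c.r := by
    intro i
    have h1 : ‖(c.YC.mulVec (sysMap c.F c.centre)) i‖ ^ 2 ≤ ((1 - c.lipConst) * c.r : ℝ) ^ 2 := by
      refine (CBox.sq_norm_le_normSqHi (c.mem_corrEncl i)).trans ?_
      exact_mod_cast hcorr i
    exact (pow_le_pow_iff_left₀ (norm_nonneg _) h0 two_ne_zero).1 h1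
  have hmaps : Set.MapsTo c.kraw c.ball c.ball := by
    intro v hv
    rw [ball, Metric.mem_closedBall, dist_eq_norm]
    have hcen : c.centre ∈ c.ball := Metric.mem_closedBall_self (by exact_mod_cast hr.le)
    have h1 : ‖c.kraw v - c.kraw c.centre‖ ≤ c.lipConst * c.r := by
      have := hlip.norm_sub_le hv hcen
      rw [hθcoe] at this
      refine this.trans (mul_le_mul_of_nonneg_left ?_ (by exact_mod_cast c.lipConst_nonneg))
      rw [← dist_eq_norm]; exact hv
    have h2 : ‖c.kraw c.centre - c.centre‖ ≤ (1 - c.lipConst) * c.r := by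
      have : c.kraw c.centre - c.centre = -(c.YC.mulVec (sysMap c.F c.centre)) := by
        simp [kraw]
      rw [this, norm_neg]
      exact (pi_norm_le_iff_of_nonneg h0).2 hcorr'
    calc ‖c.kraw v - c.centre‖
        = ‖(c.kraw v - c.kraw c.centre) + (c.kraw c.centre - c.centre)‖ := by congr 1; abel
      _ ≤ ‖c.kraw v - c.kraw c.centre‖ + ‖c.kraw c.centre - c.centre‖ := norm_add_le _ _
      _ ≤ c.lipConst * c.r + (1 - c.lipConst) * c.r := add_le_add h1 h2
      _ = c.r := by ring
  -- Banach fixed point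
  have hsc : IsComplete c.ball := Metric.isClosed_closedBall.isComplete
  have hcen : c.centre ∈ c.ball := Metric.mem_closedBall_self (by exact_mod_cast hr.le)
  have hcontr : ContractingWith θ (hmaps.restrict c.kraw c.ball c.ball) :=
    ⟨hθ1, fun x y => hlip x.2 y.2⟩
  obtain ⟨z, hzball, hzfix, -⟩ :=
    ContractingWith.exists_fixedPoint' hsc hmaps hcontr hcen (edist_ne_top _ _)
  have hzero : ∀ v : Fin c.n → ℂ, Function.IsFixedPt c.kraw v ↔ sysMap c.F v = 0 := by
    intro v
    rw [Function.IsFixedPt, kraw, sub_eq_self]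
    constructor
    · intro h; exact Matrix.eq_zero_of_mulVec_eq_zero hYdet h
    · intro h; rw [h, Matrix.mulVec_zero]
  refine ⟨⟨z, hzball, (hzero z).1 hzfix, fun z' hz' hz'0 => ?_⟩, fun v hv => ?_, hYdet⟩
  · have hfix' : Function.IsFixedPt c.kraw z' := (hzero z').2 hz'0
    have hd := hlip.dist_le_mul z' hz' z hzball
    rw [hfix'.eq, hzfix.eq, hθcoe] at hd
    have hθ' : (c.lipConst : ℝ) < 1 := by exact_mod_cast hθ
    have : dist z' z = 0 := by nlinarith [dist_nonneg (x := z') (y := z)]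
    exact dist_eq_zero.1 this
  · have := hunit v hv
    rw [Matrix.det_mul] at this
    exact right_ne_zero_of_mul this

/-! #### Consequences for `point` -/

/-- A certified code has exactly one zero of `F(v, e^v)` in its polydisc. [cite: Neumaier1991, Thm 5.1.8] -/
theorem existsUnique_zero (hc : c.Cert = true) : ∃! z, z ∈ c.ball ∧ sysMap c.F z = 0 := by
  obtain ⟨⟨z, hz, hz0, huniq⟩, -, -⟩ := c.cert_sound hc
  exact ⟨z, ⟨hz, hz0⟩, fun z' hz' => huniq z' hz'.1 hz'.2⟩

/-- The point of a certified code lies in its polydisc. [folklore] -/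
theorem point_mem_ball (hc : c.Cert = true) : c.point ∈ c.ball :=
  (c.point_spec ((c.existsUnique_zero hc).exists)).1

/-- The point of a certified code is a zero of the system. [folklore] -/
theorem sysMap_point (hc : c.Cert = true) : sysMap c.F c.point = 0 :=
  (c.point_spec ((c.existsUnique_zero hc).exists)).2

/-- The point of a certified code is a non-degenerate zero: the Jacobian there is invertible
("`A` is strongly regular"). [cite: Neumaier1991, Thm 5.1.8] -/
theorem det_sysJac_point_ne_zero (hc : c.Cert = true) : (sysJac c.F c.point).det ≠ 0 :=
  (c.cert_sound hc).2.1 _ (c.point_mem_ball hc)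

/-- [folklore] -/
theorem isNondegZero_point (hc : c.Cert = true) : IsNondegZero c.F c.point :=
  ⟨c.sysMap_point hc, c.det_sysJac_point_ne_zero hc⟩

/-- **Uniqueness**: every zero of the system in the polydisc of a certified code is its point.
[cite: Neumaier1991, Thm 5.1.8] -/
theorem eq_point (hc : c.Cert = true) {z : Fin c.n → ℂ} (hz : z ∈ c.ball) (h0 : sysMap c.F z = 0) :
    z = c.point :=
  (c.existsUnique_zero hc).unique ⟨hz, h0⟩ ⟨c.point_mem_ball hc, c.sysMap_point hc⟩

/-- Non-degenerate zeros in the integer-coefficient form used here are exactly the tree's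
`khovanskiiSolutions` of the system mapped to complex coefficients. [folklore] -/
theorem isNondegZero_iff_mem_khovanskiiSolutions {n : ℕ} (F : Fin n → MvPolynomial (Fin n ⊕ Fin n) ℤ)
    (v : Fin n → ℂ) :
    IsNondegZero F v ↔ v ∈ khovanskiiSolutions fun i => map (Int.castRingHom ℂ) (F i) := by
  rw [IsNondegZero, sysMap_eq_khovanskiiMap, sysJac_eq_kjac]
  rfl

/-- **Coordinates of points of certified codes are in the core.** Stated with the core inlined
exactly as in the route `Schanuel/ArithmeticalComplexity` (coordinates of non-degenerate zeros of
square integer exponential-polynomial systems). [cite: Kirby2010, Def. 3.1–3.2] -/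
theorem point_mem_core (hc : c.Cert = true) (j : Fin c.n) :
    c.point j ∈ {x : ℂ | ∃ (n : ℕ) (v : Fin n → ℂ) (F : Fin n → MvPolynomial (Fin n ⊕ Fin n) ℤ),
      (∃ j, v j = x) ∧ (∀ i, MvPolynomial.aeval (Sum.elim v (Complex.exp ∘ v)) (F i) = 0) ∧
      (Matrix.of fun i j => MvPolynomial.aeval (Sum.elim v (Complex.exp ∘ v))
        (MvPolynomial.pderiv (Sum.inl j) (F i) + MvPolynomial.X (Sum.inr j) *
          MvPolynomial.pderiv (Sum.inr j) (F i))).det ≠ 0} :=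
  ⟨c.n, c.point, c.F, ⟨j, rfl⟩, fun i => congrFun (c.sysMap_point hc) i,
    c.det_sysJac_point_ne_zero hc⟩

/-- **Coordinates of points of certified codes lie in Kirby's core `ecl ∅` of `ℂ_exp`.**
[cite: Kirby2010, Def. 3.1–3.2] -/
theorem point_mem_ecl (hc : c.Cert = true) (j : Fin c.n) : c.point j ∈ ecl (∅ : Set ℂ) := by
  refine ⟨c.n, c.point, fun i => map (Int.castRingHom ℂ) (c.F i), ⟨j, rfl⟩, ?_, ?_, ?_⟩
  · intro i m
    rw [coeff_map]
    exact intCast_mem _ _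
  · intro i
    have h := congrFun (c.sysMap_point hc) i
    rw [sysMap_eq_khovanskiiMap] at h
    exact h
  · have h := c.det_sysJac_point_ne_zero hc
    rw [sysJac_eq_kjac] at h
    exact h

/-! #### Countability of codes -/

/-- There are countably many Khovanskii codes. [folklore] -/
instance : Countable KhovCode := by
  have hpoly : ∀ n : ℕ, Countable (MvPolynomial (Fin n ⊕ Fin n) ℤ) := fun n => by
    rw [← Cardinal.mk_le_aleph0_iff]
    refine MvPolynomial.cardinalMk_le_max.trans ?_
    simp only [max_le_iff, le_refl, and_true]
    exact ⟨Cardinal.mk_le_aleph0, Cardinal.mk_le_aleph0⟩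
  let e : KhovCode → Σ n : ℕ, (Fin n → MvPolynomial (Fin n ⊕ Fin n) ℤ) × (Fin n → ℚ × ℚ) × ℚ ×
      (Fin n → Fin n → ℚ × ℚ) × ℕ := fun c => ⟨c.n, c.F, c.q, c.r, c.Y, c.prec⟩
  have he : Function.Injective e := by
    rintro ⟨n, F, q, r, Y, p⟩ ⟨n', F', q', r', Y', p'⟩ h
    simp only [e, Sigma.mk.injEq] at h
    obtain ⟨rfl, h⟩ := h
    simp only [heq_eq_eq, Prod.mk.injEq] at h
    obtain ⟨rfl, rfl, rfl, rfl, rfl⟩ := h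
    rfl
  exact he.countable

end KhovCode

end Literature.NumberTheory.Transcendental
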